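import Summits.CriticalPhenomena.PercolationContinuityZ3.Theorems.Transplant.Z3TallGensSkeleton
import Summits.CriticalPhenomena.PercolationContinuityZ3.Theorems.Transplant.StatementPolynomialGrowth
import Summits.CriticalPhenomena.PercolationContinuityZ3.Theorems.Transplant.StatementBenjaminiSchramm
import Literature.Barriers.CriticalPhenomena.SubexponentialGrowthZdBurtonKeane
import Literature.Probability.LatticeModels.ThermodynamicLimit
import Mathlib.Tactic.FinCases
import HarnessLib

/-!
# TALL generators, III — SCOPE: every `Cay(ℤ³; S)` with `S` tall (unit planar range, vertical range `R`) has cubic growth `|B(x,n)| ≤ R·(2n+1)³`,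
# is amenable with a.s. unique infinite cluster at every `p`, and meets every hypothesis of Benjamini–Schramm's Conjecture 4 — inside the
# conjecture's OPEN amenable-subexponential residue (outside Hutchcroft 2016 / BLPS 1999)

builds on p205010 (kernel theorem, internal audit signed; external expert review pending) — nothing in this file uses p205010.
Lane `prim-bschramm`, seat `prim-bschramm-p2` (gen 11; class C1b); helper file (`--supports stmt-CriticalPhenomena-4575 --as helper`); PROOFS ONLY, pattern =
p1-g12's `Z3UnitGensScope` (p295005) with the one change that a walk of length `n` moves the VERTICAL coordinate by `≤ n·R` (`R = TallGens.vrange`), so the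
ball sits in the box `[−n,n]² × [−nR, nR]`.  Memo: `HOME/bschramm/P2-LATTICES.md` §32.  Purpose: the scope record the N1 closing protocol cites for the tall customers
(`TallGens.criticalContinuity_of_negNode₁`, `Z3TallGensSign`): the (U) input is automatic on the family, and the family lies in Conj. 4's open residue.
* §1 `abs_sub_le_length` / `abs_sub_two_le_length`, **`ballVolume_le : |B(x,n)| ≤ (2n+1)²(2nR+1)`**, `ballVolume_le' : ≤ R(2n+1)³`, `polynomialGrowth` (`C = 8R`, `D = 3`),
  `not_hasExponentialGrowth`;
* §2 `isPretransitive_aut`, **`isGraphAmenable`**, **`numInfiniteClusters_le_one`** (Burton–Keane, every `p`);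
* §3 **`in_scope`**, `criticalProb_lt_one'`, `criticalContinuity_of_conj4 / _of_conj4_polynomialGrowth / _of_conj4_amenableSubexponential`.
[cite: BenjaminiSchramm1996, §2 and Conj. 4] [cite: LyonsPeres2016, §6.1, Thm. 7.6] [cite: BurtonKeane1989, Thm. 2] [cite: Hutchcroft2016, Thm. 1]
-/

noncomputable section

namespace Summit.CriticalPhenomena.PercolationContinuityZ3.Theorems.Transplant

open MeasureTheory Filter Literature.Probability.Percolation Literature.Probability.LatticeModels SimpleGraph
open Literature.Barriers.CriticalPhenomena (IsQuasiTransitive IsGraphTransitive IsGraphAmenable HasExponentialGrowth graphBall ballVolume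
  hasExponentialGrowth_of_not_isGraphAmenable eventually_pow_lt_const_pow BurtonKeane1989_atMostOneInfiniteCluster_holds)
open scoped Classical

namespace TallGens

variable (T : TallGens)

/-! ## §1 Cubic growth -/

/-- Along a walk of length `n` the two PLANAR coordinates move by at most `n`. [folklore] -/
theorem abs_sub_le_length {x y : Site 3} (w : T.graph.Walk x y) : |y 0 - x 0| ≤ (w.length : ℤ) ∧ |y 1 - x 1| ≤ (w.length : ℤ) := by
  induction w with
  | nil => simp
  | @cons a b c hab w ih =>
    have h1 := T.abs_sub_le_of_adj hab
    have h2 : |c 0 - a 0| ≤ |c 0 - b 0| + |b 0 - a 0| := by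
      have := abs_sub_le (c 0) (b 0) (a 0); linarith
    have h3 : |c 1 - a 1| ≤ |c 1 - b 1| + |b 1 - a 1| := by
      have := abs_sub_le (c 1) (b 1) (a 1); linarith
    simp only [SimpleGraph.Walk.length_cons, Nat.cast_add, Nat.cast_one]
    constructor <;> linarith [h1.1, h1.2, ih.1, ih.2]

/-- Along a walk of length `n` the VERTICAL coordinate moves by at most `n·R`. [folklore] -/
theorem abs_sub_two_le_length {x y : Site 3} (w : T.graph.Walk x y) : |y 2 - x 2| ≤ (w.length : ℤ) * T.vrange := by
  induction w with
  | nil => simp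
  | @cons a b c hab w ih =>
    have h1 := T.abs_sub_two_le_of_adj hab
    have h2 : |c 2 - a 2| ≤ |c 2 - b 2| + |b 2 - a 2| := by
      have := abs_sub_le (c 2) (b 2) (a 2); linarith
    simp only [SimpleGraph.Walk.length_cons, Nat.cast_add, Nat.cast_one]
    linarith

/-- **Cubic growth of every tall `Cay(ℤ³; S)`**: `|B(x,n)| ≤ (2n+1)²·(2nR+1)` (the ball, translated by `−x`, sits in the box `[−n,n]² × [−nR,nR]`).
[cite: LyonsPeres2016, §6.1 (growth of balls)] -/
theorem ballVolume_le (x : Site 3) (n : ℕ) : ballVolume T.graph x n ≤ (2 * n + 1) * (2 * n + 1) * (2 * (n * T.vrange) + 1) := by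
  set f : Site 3 → Site 3 := fun y => y - x with hf
  have hinj : Function.Injective f := fun y z h => sub_left_injective h
  set B : Finset (Site 3) := Fintype.piFinset ![Finset.Icc (-(n : ℤ)) n, Finset.Icc (-(n : ℤ)) n,
    Finset.Icc (-((n * T.vrange : ℕ) : ℤ)) (n * T.vrange : ℕ)] with hB
  have hBcard : B.card = (2 * n + 1) * (2 * n + 1) * (2 * (n * T.vrange) + 1) := by
    rw [hB, Fintype.card_piFinset, Fin.prod_univ_three]
    simp only [Matrix.cons_val_zero, Matrix.cons_val_one, Matrix.cons_val]
    rw [Int.card_Icc, Int.card_Icc]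
    have h1 : ((n : ℤ) + 1 - -(n : ℤ)).toNat = 2 * n + 1 := by omega
    have h2 : (((n * T.vrange : ℕ) : ℤ) + 1 - -((n * T.vrange : ℕ) : ℤ)).toNat = 2 * (n * T.vrange) + 1 := by omega
    rw [h1, h2]
  have hsub : f '' graphBall T.graph x n ⊆ (↑B : Set (Site 3)) := by
    rintro _ ⟨y, ⟨w, hw⟩, rfl⟩
    rw [Finset.mem_coe, hB, Fintype.mem_piFinset]
    have hn : (w.length : ℤ) ≤ n := by exact_mod_cast hw
    have hp := T.abs_sub_le_length w
    have hv := T.abs_sub_two_le_length w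
    have hR : (w.length : ℤ) * T.vrange ≤ ((n * T.vrange : ℕ) : ℤ) := by
      push_cast; exact mul_le_mul_of_nonneg_right hn (by positivity)
    intro i
    fin_cases i
    · have h := abs_le.1 (hp.1.trans hn)
      simpa [hf, Finset.mem_Icc] using h
    · have h := abs_le.1 (hp.2.trans hn)
      simpa [hf, Finset.mem_Icc] using h
    · have h := abs_le.1 (hv.trans hR)
      change (y - x) 2 ∈ Finset.Icc (-((n * T.vrange : ℕ) : ℤ)) (n * T.vrange : ℕ)
      rw [Finset.mem_Icc, Pi.sub_apply]
      exact ⟨h.1, h.2⟩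
  unfold ballVolume
  rw [← Set.ncard_image_of_injective _ hinj, ← hBcard, ← Set.ncard_coe_finset]
  exact Set.ncard_le_ncard hsub B.finite_toSet

/-- `1 ≤ R` (`e₂ ∈ S`). [folklore] -/
theorem one_le_vrange : 1 ≤ T.vrange := by
  have h : (Z3Diag.ev 2 2).natAbs ≤ T.vrange := Finset.le_sup (f := fun s : Site 3 => (s 2).natAbs) (T.axes 2)
  simpa [Z3Diag.ev] using h

/-- The isotropic form: `|B(x,n)| ≤ R·(2n+1)³`. [cite: LyonsPeres2016, §6.1] -/
theorem ballVolume_le' (x : Site 3) (n : ℕ) : ballVolume T.graph x n ≤ T.vrange * (2 * n + 1) ^ 3 := by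
  refine (T.ballVolume_le x n).trans ?_
  have hR := T.one_le_vrange
  have h : 2 * (n * T.vrange) + 1 ≤ T.vrange * (2 * n + 1) := by nlinarith
  calc (2 * n + 1) * (2 * n + 1) * (2 * (n * T.vrange) + 1) ≤ (2 * n + 1) * (2 * n + 1) * (T.vrange * (2 * n + 1)) :=
        Nat.mul_le_mul_left _ h
    _ = T.vrange * (2 * n + 1) ^ 3 := by ring

/-- Uniform polynomial growth of every tall `Cay(ℤ³; S)` (`C = 8R`, `D = 3`). [cite: LyonsPeres2016, §6.1] -/
theorem polynomialGrowth : ∃ C D : ℝ, ∀ (x : Site 3) (n : ℕ), (ballVolume T.graph x n : ℝ) ≤ C * ((n : ℝ) + 1) ^ D := by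
  refine ⟨8 * T.vrange, ((3 : ℕ) : ℝ), fun x n => ?_⟩
  rw [Real.rpow_natCast]
  have h1 : (ballVolume T.graph x n : ℝ) ≤ T.vrange * (2 * n + 1) ^ 3 := by exact_mod_cast T.ballVolume_le' x n
  have hR : (0 : ℝ) ≤ T.vrange := by positivity
  have h2 : (T.vrange : ℝ) * ((2 : ℝ) * n + 1) ^ 3 ≤ 8 * T.vrange * ((n : ℝ) + 1) ^ 3 := by
    have : ((2 : ℝ) * n + 1) ^ 3 ≤ 8 * ((n : ℝ) + 1) ^ 3 := by
      have : (2 : ℝ) * n + 1 ≤ 2 * ((n : ℝ) + 1) := by linarith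
      calc ((2 : ℝ) * n + 1) ^ 3 ≤ (2 * ((n : ℝ) + 1)) ^ 3 := pow_le_pow_left₀ (by positivity) this 3
        _ = 8 * ((n : ℝ) + 1) ^ 3 := by ring
    nlinarith
  exact h1.trans h2

/-- **No tall `Cay(ℤ³; S)` has exponential growth** — the family lies OUTSIDE Hutchcroft's theorem. [cite: Hutchcroft2016, Thm. 1] -/
theorem not_hasExponentialGrowth : ¬ HasExponentialGrowth T.graph := by
  intro h
  obtain ⟨c, hc, hev⟩ := h (0 : Site 3)
  have hev4 := eventually_pow_lt_const_pow 4 hc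
  -- eventually `R (2n+1)³ ≤ (2n+1)⁴` (as soon as `2n+1 ≥ R`)
  have hcube : ∀ᶠ n : ℕ in atTop, (T.vrange : ℝ) * (2 * n + 1) ^ 3 ≤ (2 * (n : ℝ) + 1) ^ 4 := by
    refine (eventually_ge_atTop T.vrange).mono fun n hn => ?_
    have hn' : (T.vrange : ℝ) ≤ 2 * n + 1 := by
      have : (T.vrange : ℝ) ≤ n := by exact_mod_cast hn
      linarith [(Nat.cast_nonneg n : (0 : ℝ) ≤ n)]
    calc (T.vrange : ℝ) * (2 * n + 1) ^ 3 ≤ (2 * n + 1) * (2 * (n : ℝ) + 1) ^ 3 := mul_le_mul_of_nonneg_right hn' (by positivity)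
      _ = (2 * (n : ℝ) + 1) ^ 4 := by ring
  obtain ⟨n, hn1, hn2, hn3⟩ := (hev.and (hev4.and hcube)).exists
  have hvol : (ballVolume T.graph (0 : Site 3) n : ℝ) ≤ T.vrange * (2 * n + 1) ^ 3 := by exact_mod_cast T.ballVolume_le' _ n
  linarith

/-! ## §2 Transitivity (Mathlib spelling), amenability, uniqueness of the infinite cluster -/

/-- `Aut(Cay(ℤ³; S))` acts transitively on the vertices, in Mathlib's spelling (the translations `T.shift`). [cite: BenjaminiSchramm1996, §2] -/
theorem isPretransitive_aut : MulAction.IsPretransitive (T.graph ≃g T.graph) (Site 3) :=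
  (isPretransitive_aut_iff T.graph).2 T.graph_transitive

/-- **Every tall `Cay(ℤ³; S)` is amenable** (subexponential growth; Lyons–Peres §6.1 contrapositive). [cite: LyonsPeres2016, §6.1 (p. 279)] -/
theorem isGraphAmenable : IsGraphAmenable T.graph := by
  by_contra h
  exact T.not_hasExponentialGrowth (hasExponentialGrowth_of_not_isGraphAmenable _ T.graph_quasiTransitive h)

/-- **Uniqueness of the infinite cluster on every tall `Cay(ℤ³; S)` at every density** (Burton–Keane for connected quasi-transitive amenable
graphs, tree). [cite: BurtonKeane1989, Thm. 2] [cite: LyonsPeres2016, Thm. 7.6] -/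
theorem numInfiniteClusters_le_one (p : unitInterval) : ∀ᵐ ω ∂(bondPercolation T.graph p), numInfiniteClusters ω ≤ 1 :=
  BurtonKeane1989_atMostOneInfiniteCluster_holds _ T.graph_connected T.graph_quasiTransitive T.isGraphAmenable p

/-! ## §3 In scope of Conjecture 4, outside the printed theorems -/

/-- **Every tall `Cay(ℤ³; S)` meets every hypothesis of Benjamini–Schramm's Conjecture 4, with cubic growth, amenability and uniqueness**:
connected, `Aut`-transitive, `|B(x,n)| ≤ R(2n+1)³`, no exponential growth, amenable, a.s. at most one infinite cluster at every `p`, `0 ≤ p_c < 1`.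
[cite: BenjaminiSchramm1996, Conj. 4 and §2] [cite: LyonsPeres2016, §6.1, Thm. 7.6] [cite: BurtonKeane1989, Thm. 2] -/
theorem in_scope :
    T.graph.Connected ∧ MulAction.IsPretransitive (T.graph ≃g T.graph) (Site 3) ∧ IsQuasiTransitive T.graph ∧
      (∀ (x : Site 3) (n : ℕ), ballVolume T.graph x n ≤ T.vrange * (2 * n + 1) ^ 3) ∧ ¬ HasExponentialGrowth T.graph ∧ IsGraphAmenable T.graph ∧
      (∀ p : unitInterval, ∀ᵐ ω ∂(bondPercolation T.graph p), numInfiniteClusters ω ≤ 1) ∧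
      0 ≤ criticalProb T.graph (0 : Site 3) ∧ criticalProb T.graph (0 : Site 3) < 1 :=
  ⟨T.graph_connected, T.isPretransitive_aut, T.graph_quasiTransitive, T.ballVolume_le', T.not_hasExponentialGrowth, T.isGraphAmenable,
    T.numInfiniteClusters_le_one, (criticalProb_mem_Icc T.graph (0 : Site 3)).1, T.criticalProb_lt_one⟩

/-- `p_c < 1` at every vertex of a tall `Cay(ℤ³; S)` (transport along the translations). [cite: BenjaminiSchramm1996, Thm. 1] -/
theorem criticalProb_lt_one' (v : Site 3) : criticalProb T.graph v < 1 := by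
  have hpc := criticalProb_iso (T.shift v) (0 : Site 3)
  have hv : T.shift v 0 = v := by simp
  rw [hv] at hpc
  rw [hpc]; exact T.criticalProb_lt_one

/-- Conjecture 4 implies `θ(p_c) = 0` at every vertex of every tall `Cay(ℤ³; S)`. [cite: BenjaminiSchramm1996, Conj. 4] -/
theorem criticalContinuity_of_conj4 (h : BenjaminiSchramm1996_conj4) (v : Site 3) : theta T.graph v (criticalProbIOf T.graph v) = 0 :=
  h T.graph T.graph_connected T.graph_quasiTransitive v (T.criticalProb_lt_one' v)

/-- The polynomial-growth spelling of Conjecture 4 implies `θ(p_c) = 0` on every tall `Cay(ℤ³; S)`. [cite: BenjaminiSchramm1996, Conj. 4] -/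
theorem criticalContinuity_of_conj4_polynomialGrowth (h : BenjaminiSchramm1996_conj4_polynomialGrowth) (v : Site 3) :
    theta T.graph v (criticalProbIOf T.graph v) = 0 :=
  h T.graph T.graph_connected T.graph_quasiTransitive T.polynomialGrowth v (T.criticalProb_lt_one' v)

/-- **The amenable-subexponential residue of Conjecture 4 (the part OPEN in print) implies `θ(p_c) = 0` on every tall `Cay(ℤ³; S)`** — the family
lies in the residue, not in Hutchcroft's / BLPS's classes. [cite: BenjaminiSchramm1996, Conj. 4] [cite: Hutchcroft2016, Thm. 1] -/
theorem criticalContinuity_of_conj4_amenableSubexponential (h : BenjaminiSchramm1996_conj4_amenableSubexponential) (v : Site 3) :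
    theta T.graph v (criticalProbIOf T.graph v) = 0 :=
  h T.graph T.graph_connected T.graph_quasiTransitive T.isGraphAmenable T.not_hasExponentialGrowth v (T.criticalProb_lt_one' v)

end TallGens

end Summit.CriticalPhenomena.PercolationContinuityZ3.Theorems.Transplant

end
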